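import Mathlib
import Literature.Analysis.FluidPDE.SelfSimilar
import Literature.Analysis.FluidPDE.AxisymmetricEuler
import Literature.Analysis.FluidPDE.AxisymmetricReflection
import Literature.Analysis.FluidPDE.TypeIAncientMild
import Literature.Analysis.FluidPDE.PineauVicolRSS
import Literature.Analysis.FluidPDE.OseenZoomCovariance
import Literature.Analysis.FluidPDE.OseenMildUniqueness
import Literature.Analysis.FluidPDE.PineauVicolRDSSLeray
import Literature.Analysis.FluidPDE.PineauVicolRSSChaeWolf
import Summits.NavierStokesRegularity.NavierStokesRegularity.Theorems.QuantisedSymmetryPolyhedralDssProfileExistsStubAncientMildOfClassicalTypeI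
import Summits.NavierStokesRegularity.NavierStokesRegularity.Theorems.DssFarFieldSlavingBlowupTypeIDssProfileSmoothRepresentativeAe
import Summits.NavierStokesRegularity.NavierStokesRegularity.Theorems.DssFarFieldSlavingBlowupTypeIDssProfileAxisymmetricEmpty
import Summits.NavierStokesRegularity.NavierStokesRegularity.Theorems.DssFarFieldSlavingBlowupTypeIDssProfileClassToProfile
import Summits.NavierStokesRegularity.NavierStokesRegularity.Theorems.CorkscrewDynamoCorkscrewProfileAngleTools
import HarnessLib

/-!
# K0d — rotation-reversing inertial isotropy with an infinite-order twist: the cell is EMPTY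
  (route `DssFarFieldSlaving`, crux `BlowupTypeIDssProfile`, stmt-NavierStokesRegularity-0155 —
  SUPPORT; cell pub-ns-dss theory seat, red R-31(b), lead A37/A45; landed by the typer from the
  theory seat's tree-ready file HOME/theory/ReversingIsotropyEmpty.lean v1.7a, sha256[16] 3756fc160d143494)

`rdssClass_reversing_infiniteOrder_empty`: no ancient mild solution with measurable slices, Type-I
decay `‖u(t,x)‖ ≤ M/(‖x‖ + √(−t))`, rotated-DSS with factor `c > 1` and twist `R_θ`, `θ/π ∉ ℚ`, whose
slices are a.e.-equivariant under ONE linear isometry `g` reversing the sense of rotation about the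
axis (`g R_φ = R_{−φ} g`: vertical mirrors — `reversesRotZ_reflY` —, horizontal `C₂` axes, …), is
non-trivial. PROOF (theory seat): conjugating the self-similarity by `g` shows that the smooth
representative's slices are `R_{2θ}`-equivariant (`twistSq_equivariant_of_reverses`, pure
algebra); equivariance of a continuous field under one irrational rotation is axisymmetry (tree:
`CorkscrewProfile.Birth.isAxisymmetric_of_equivariant_irrational`); KNSS 2009 Thm 5.3
(`typeI_ancient_axisymmetric_ae_zero`) kills axisymmetric slices. LEVEL: class level (H0–H6 of
`FilamentSkeletonRss.RdssProfileTruncation` with `R = rotZLIE θ`). NOT covered: finite-order twists and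
the CO-ROTATING mirror cell (the latter is `…MirrorCorotating.lean`).

Typer changes w.r.t. the theory file: the predicate `ReversesRotZ g` is written out as the explicit
hypothesis `∀ φ y, g (rotZ φ y) = rotZ (−φ) (g y)` (no definitions in a proof file); the a.e. →
pointwise equivariance step and the dense-angle closure use their tree originals
(`equivariant_of_ae_equivariant`, `CorkscrewProfile.Birth.isAxisymmetric_of_equivariant_irrational`).
[cite: KochNadirashviliSereginSverak2009, Thm 5.3 (arXiv:0709.3599)]
-/

noncomputable section

set_option linter.dupNamespace false

namespace Summit.NavierStokesRegularity.NavierStokesRegularity.Theorems.ReversingIsotropy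

open MeasureTheory Set Function Filter Metric
open Literature.Analysis.FluidPDE
open Summit.NavierStokesRegularity.NavierStokesRegularity.Theorems
open scoped Topology

/-- Rotations about the axis commute with scalar multiplication (via the bundled `rotZL`). -/
private theorem rotZ_smul' (θ c : ℝ) (y : (EuclideanSpace ℝ (Fin 3))) : rotZ θ (c • y) = c • rotZ θ y := by
  rw [← rotZL_apply, map_smul, rotZL_apply]

set_option linter.unnecessarySeqFocus false in
/-- The meridian mirror `reflY (x₀,x₁,x₂) = (x₀,−x₁,x₂)` reverses rotations. -/
theorem reversesRotZ_reflY : (∀ φ y, reflY (rotZ φ y) = rotZ (-φ) (reflY y)) := by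
  intro φ y
  ext i
  fin_cases i <;> simp [reflY, Real.cos_neg, Real.sin_neg] <;> ring


/-- **The twist squared is a symmetry**: rotated-DSS with twist `R_θ` + pointwise equivariance of the
slices under a rotation-reversing `g` ⇒ the slices are `R_{−2θ}`-equivariant. Pure algebra. -/
theorem twistSq_equivariant_of_reverses {c θ : ℝ} (hc : 0 < c) {g : (EuclideanSpace ℝ (Fin 3)) ≃ₗᵢ[ℝ] (EuclideanSpace ℝ (Fin 3))}
    (hg : (∀ φ y, g (rotZ φ y) = rotZ (-φ) (g y)))
    {V : ℝ → (EuclideanSpace ℝ (Fin 3)) → (EuclideanSpace ℝ (Fin 3))} (hR : IsRotatedDSS c (rotZLIE θ) V)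
    (hGV : ∀ t < 0, ∀ x, V t (g x) = g (V t x)) :
    ∀ t < 0, ∀ x, V t (rotZ (-(2 * θ)) x) = rotZ (-(2 * θ)) (V t x) := by
  intro t ht x
  have hct : c ^ 2 * t < 0 := mul_neg_of_pos_of_neg (by positivity) ht
  have hcne : c ≠ 0 := hc.ne'
  -- the RDSS identity at the point `R_{-2θ} x`
  have h1 := hR t (rotZ (-(2 * θ)) x)
  simp only [rotZLIE_apply, rotZLIE_symm_apply] at h1
  have e1 : rotZ θ (rotZ (-(2 * θ)) x) = rotZ (-θ) x := by
    rw [← rotZ_add]; congr 1; ring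
  have e2 : rotZ (-θ) x = g (rotZ θ (g.symm x)) := by
    rw [hg, LinearIsometryEquiv.apply_symm_apply]
  rw [e1, e2, ← LinearIsometryEquiv.map_smul, hGV _ hct] at h1
  -- the RDSS identity at the point `g⁻¹ x`
  have h2 := hR t (g.symm x)
  simp only [rotZLIE_apply, rotZLIE_symm_apply] at h2
  set A := V (c ^ 2 * t) (c • rotZ θ (g.symm x)) with hA
  -- solve h2 for `A`
  have hA' : A = rotZ θ (c⁻¹ • V t (g.symm x)) := by
    have h3 : rotZ (-θ) A = c⁻¹ • V t (g.symm x) := by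
      rw [← h2, smul_smul, inv_mul_cancel₀ hcne, one_smul]
    have h4 : rotZ θ (rotZ (-θ) A) = A := by
      rw [← rotZ_add, add_neg_cancel, rotZ_zero]
    rw [← h4, h3]
  rw [← h1, hA', hg, ← rotZ_add, LinearIsometryEquiv.map_smul, rotZ_smul', smul_smul,
    mul_inv_cancel₀ hcne, one_smul, ← hGV t ht, LinearIsometryEquiv.apply_symm_apply]
  congr 1; ring


/-- **K0d (class level): rotation-reversing inertial isotropy + infinite-order twist ⇒ EMPTY.**
Hypothesis list = `RdssProfileTruncation`'s with `R = R_θ`, `θ/π ∉ ℚ`, plus a.e. `g`-equivariance of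
the slices for ONE rotation-reversing isometry `g`. -/
theorem rdssClass_reversing_infiniteOrder_empty {θ : ℝ} (hθ : Irrational (θ / Real.pi))
    {g : (EuclideanSpace ℝ (Fin 3)) ≃ₗᵢ[ℝ] (EuclideanSpace ℝ (Fin 3))} (hg : (∀ φ y, g (rotZ φ y) = rotZ (-φ) (g y))) (M : ℝ) :
    ¬ ∃ (c : ℝ) (u : ℝ → (EuclideanSpace ℝ (Fin 3)) → (EuclideanSpace ℝ (Fin 3))), 1 < c ∧ IsAncientMildSolution 1 u ∧
      (∀ t < 0, AEStronglyMeasurable (u t) volume) ∧ IsRotatedDSS c (rotZLIE θ) u ∧ HasTypeIDecay M u ∧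
      (∀ t < 0, (fun x => u t (g x)) =ᵐ[volume] fun x => g (u t x)) ∧
      ¬ (∀ t < 0, u t =ᵐ[volume] 0) := by
  rintro ⟨c, u, hc, hmild, hmeas, hR, hdec, hG, hne⟩
  obtain ⟨V, hT, hRV, hVdec, hVu, hV0⟩ := rdssClass_smoothRepresentative_ae hc hmild hmeas hR hdec
  have hVc : ∀ t < 0, Continuous (V t) := fun t ht => by
    have h : ContinuousOn (uncurry V ∘ fun x : (EuclideanSpace ℝ (Fin 3)) => (t, x)) univ :=
      hT.1.continuousOn.comp (continuous_const.prodMk continuous_id).continuousOn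
        fun x _ => ⟨ht, mem_univ _⟩
    exact (continuousOn_univ.1 h).congr fun x => rfl
  have hGV : ∀ t < 0, ∀ x, V t (g x) = g (V t x) := fun t ht =>
    equivariant_of_ae_equivariant g (hVc t ht) (hVu t ht) (hG t ht)
  have hsq := twistSq_equivariant_of_reverses (by linarith) hg hRV hGV
  have hψ : Irrational (-(2 * θ) / (2 * Real.pi)) := by
    rw [show -(2 * θ) / (2 * Real.pi) = -(θ / Real.pi) by field_simp]
    exact hθ.neg
  have hax : ∀ t < 0, IsAxisymmetric (V t) := fun t ht =>
    CorkscrewProfile.Birth.isAxisymmetric_of_equivariant_irrational (hVc t ht) hψ (hsq t ht)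
  have hVmeas : ∀ t < 0, AEStronglyMeasurable (V t) volume := fun t ht =>
    (hVc t ht).aestronglyMeasurable
  have hV0' := typeI_ancient_axisymmetric_ae_zero hT.isAncientMildSolution hVmeas hVdec hax
  exact hne fun t ht => (hVu t ht).symm.trans (hV0' t ht)

end Summit.NavierStokesRegularity.NavierStokesRegularity.Theorems.ReversingIsotropy

end
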